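import Summits.ValiantsHypothesis.ValiantsHypothesis.Theorems.TwoProducts.RankThreeAffineOLMColumnsFlag

/-!
# OLM slot, column ladder part 4: the SKIP case — canonical columns are SUB-flag Wronskians, UNCONDITIONALLY; «OLMLaw ⟸ (TW-flag)» typed

Part 3 (✓ `…RankThreeAffineOLMColumnsFlag`) identified the canonical pivot columns `canCol u e j i` of the column ladder with flag toric Wronskians
under the hypothesis `hW` «no flag Wronskian vanishes» — which FAILS on the full OLM triangle (val-idea-crit-8 g5 #100 (C3-b): the columns
`{X^s : s ∈ supp u} ∪ {1}` are ℂ[u]-dependent).  THIS FILE removes `hW` WITHOUT the ℂ(u)-basis / denominator-clearing reduction of the scratch report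
(44e1e76fa8779622 §1): the ladder's own SKIP branch IS the basis selection.  Invariant (★ `canCol_eq_subflag`): at every step `j` there are a sub-family
`f = (e_{g_0}, …, e_{g_{l−1}})` of the exponents (the SURVIVING pivots so far, `l ≤ j`) and a constant `c ≠ 0` with `W_{J(·,u)}(X^f) ≠ 0` and
`canCol u e j i = c · W_{J(·,u)}(X^{f}, X^{e_i})` for ALL `i`; a vanished pivot leaves `(f, c)` unchanged, a live one maps `(f, c) ↦ ((f, e_j), c²·W(X^f))`
(✓ `newCol_smul` + ✓ `newCol_wronskian` = Sylvester for `D = J(·,u)`, val-port-1 g5's ✓ `wronskian_sylvester`), and `|Eset σ c| ≤ j·B` whenever `B` bounds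
the edge directions of the Wronskians of all sub-families of `e` of length `≤ K` (✓ `Eset_mul_subset`, ✓ `Eset_pow_subset`).
Hence, with NO hypothesis on `u`, `e`, `ψ`: ★ `card_Eset_canCol_le_of_subflag` `|Eset σ (canCol u e j j)| ≤ K·B`, ★ `colResidue_le_of_subflag`
`colResidue σ u e ≤ K²·B`, and since a `TWFlagBound Q` bounds every family of length `l ≤ K` (pad it to length `K`, ✓ `twFlagBound_family`):
★★ `olmColumns_nv_le_of_twFlag_skip`: `TWFlagBound Q → nv (Σ_{i<K} X^{e_i}·ψ_i(u)) ≤ 2·(3K(t²+t) + 3K + 3K²·Q K t) + 4` for ALL `e`, `ψ`, `u`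
(`|supp u| ≤ t`).  Packaged in the OLM slot (✓ `aeval_olm_eq_columnSum`, `K = #columns ≤ (m+1)²` by ★ `card_ufree_image_le`):
★★ `olm_nv_le_pow_of_twFlag`: `TWFlagBound Q ∧ (Q K t ≤ (K+2)^a (t+2)^a) → ∃ c, ∀ m t P u, deg P ≤ m → |supp u| ≤ t →
nv (P(x, y, u)) ≤ (m+2)^c (t+2)^c` — literally the body of `OLMLaw` (typed by val-idea-35 g11 in the Cruxes workfile; NOT restated as a `def` here, and
Cruxes files are not imported: the holder of `OLMLaw` discharges it by `exact olm_nv_le_pow_of_twFlag hQ hQa`).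
WHAT THIS MOVES AND WHAT IT DOES NOT: the OLM slot (k-uniformity (B2)/(B3)) is now REDUCED, sorry-free and by name, to ONE counting statement on toric
Wronskians of monomial families w.r.t. `J(·,u)` — `TWFlagBound Q` with `Q` polynomial.  DISCHARGED so far only on single-resonance-line families
(✓ (W1) `toricW_card_Eset_ray_le`, p711636, `t²+t`); several lines / merged resonances are OPEN (residue sentence of record, crit-8 g5 #98; conjecture C2 of
NOTE e7f9f5e1cec2d957 for the no-merge top).  `TWFlagBound` is a HYPOTHESIS SHAPE, not asserted; no Prop-`def` is introduced in this file.
HONEST LABEL: located cell / typed reduction on the OPEN rung 3-AFF (side ladder, crux `stmt-ValiantsHypothesis-5906` `TwoProducts`); NOT γ; `OLMLaw` /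
`RankThreeAffineLaw(Exp)` / `TwoProducts` / PCB / `ResidualLawV25` UNMOVED (OLMLaw becomes CONDITIONAL on (TW-flag), nothing more); 0 summit distance;
VP ≠ VNP is NOT proved.  `--supports stmt-ValiantsHypothesis-5906 --as helper` (val-port-4 g5; critic of record val-idea-crit-8 g5).  No instances, no
notation, no named facts. [folklore]
-/

noncomputable section
set_option linter.dupNamespace false

namespace Summit.ValiantsHypothesis.ValiantsHypothesis.Theorems.TwoProducts.RankTwoJacobian

open scoped BigOperators Pointwise
open MvPolynomial
open Literature.LinearAlgebra.Matrix (wronskianMatrix wronskian wronskianMatrix_apply wronskian_def)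

section TowerKernel
open scoped Classical

/-! ### §1 The skip invariant: canonical columns = sub-flag Wronskians -/

/-- taking monomials commutes with appending an exponent. [folklore] -/
theorem snoc_monomialFamily {l : ℕ} (f : Fin l → Expo) (a : Expo) :
    (fun k => monomial ((Fin.snoc f a : Fin (l + 1) → Expo) k) (1 : ℂ) : Fin (l + 1) → Poly2) =
      Fin.snoc (fun k => monomial (f k) (1 : ℂ)) (monomial a (1 : ℂ)) := by
  funext k
  refine Fin.lastCases ?_ (fun k' => ?_) k
  · simp only [Fin.snoc_last]
  · simp only [Fin.snoc_castSucc]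

/-- ★ **THE SKIP INVARIANT.** If `B` bounds the edge directions (chart `σ`) of the `J(·,u)`-Wronskians of all monomial sub-families of `e` of length
`≤ K`, then for every `j ≤ K` there are a sub-family `f` of `e` of length `l ≤ j` (the surviving pivots) and a constant `c ≠ 0` with
`W(X^f) ≠ 0`, `|Eset σ c| ≤ j·B`, and `canCol u e j i = c · W_{J(·,u)}(X^{f}, X^{e_i})` for all `i`.  No hypothesis on `u` or `e`. -/
theorem canCol_eq_subflag {σ : ℝ} (hσ : σ = 1 ∨ σ = -1) {K : ℕ} (u : Poly2) (e : Fin K → Expo) {B : ℕ}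
    (hB : ∀ l, l ≤ K → ∀ f : Fin l → Expo, (∀ k, ∃ i, f k = e i) →
      (Eset σ (wronskian (⇑(jacDer u)) (fun k => monomial (f k) (1 : ℂ)))).card ≤ B) :
    ∀ j, j ≤ K → ∃ (l : ℕ) (f : Fin l → Expo) (c : Poly2), l ≤ j ∧ (∀ k, ∃ i, f k = e i) ∧ c ≠ 0 ∧
      wronskian (⇑(jacDer u)) (fun k => monomial (f k) (1 : ℂ)) ≠ 0 ∧ (Eset σ c).card ≤ j * B ∧
      ∀ i : Fin K, canCol u e j i =
        c * wronskian (⇑(jacDer u)) (Fin.snoc (fun k => monomial (f k) (1 : ℂ)) (monomial (e i) (1 : ℂ))) := by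
  intro j
  induction j with
  | zero =>
    intro _
    refine ⟨0, fun k => k.elim0, 1, le_rfl, fun k => k.elim0, one_ne_zero, ?_, ?_, fun i => ?_⟩
    · rw [wronskian_def, Matrix.det_fin_zero]; exact one_ne_zero
    · rw [Nat.zero_mul, ← C_1, Eset_C, Finset.card_empty]
    · show monomial (e i) 1 = 1 * _
      rw [one_mul, wronskian_def, Matrix.det_fin_one, wronskianMatrix_apply]
      simp [Fin.snoc]
  | succ j ih =>
    intro hj
    have hjK : j < K := by omega
    obtain ⟨l, f, c, hl, hf, hc, hWf, hcard, hcol⟩ := ih (by omega)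
    by_cases h0 : canCol u e j ⟨j, hjK⟩ = 0
    · -- vanished pivot: the column functions and the witnesses are unchanged
      have hstep : ∀ i, canCol u e (j + 1) i = canCol u e j i := by
        intro i
        show (if ∃ hj : j < K, canCol u e j ⟨j, hj⟩ = 0 then canCol u e j i
          else if hj : j < K then newCol u (canCol u e j ⟨j, hj⟩) (canCol u e j i) else canCol u e j i) = canCol u e j i
        rw [if_pos ⟨hjK, h0⟩]
      refine ⟨l, f, c, by omega, hf, hc, hWf, hcard.trans (Nat.mul_le_mul_right _ (by omega)), fun i => ?_⟩
      rw [hstep i, hcol i]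
    · -- live pivot: the Sylvester step appends `e_j` to the surviving family
      have hWg : wronskian (⇑(jacDer u))
          (Fin.snoc (fun k => monomial (f k) (1 : ℂ)) (monomial (e ⟨j, hjK⟩) (1 : ℂ))) ≠ 0 := by
        intro h; exact h0 (by rw [hcol ⟨j, hjK⟩, h, mul_zero])
      have hstep : ∀ i, canCol u e (j + 1) i = newCol u (canCol u e j ⟨j, hjK⟩) (canCol u e j i) := by
        intro i
        show (if ∃ hj : j < K, canCol u e j ⟨j, hj⟩ = 0 then canCol u e j i
          else if hj : j < K then newCol u (canCol u e j ⟨j, hj⟩) (canCol u e j i) else canCol u e j i) = _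
        rw [if_neg (fun ⟨_, h⟩ => h0 h), dif_pos hjK]
      refine ⟨l + 1, Fin.snoc f (e ⟨j, hjK⟩), c ^ 2 * wronskian (⇑(jacDer u)) (fun k => monomial (f k) (1 : ℂ)),
        by omega, fun k => ?_, mul_ne_zero (pow_ne_zero 2 hc) hWf, ?_, ?_, fun i => ?_⟩
      · refine Fin.lastCases ?_ (fun k' => ?_) k
        · exact ⟨⟨j, hjK⟩, by simp only [Fin.snoc_last]⟩
        · obtain ⟨i, hi⟩ := hf k'
          exact ⟨i, by simp only [Fin.snoc_castSucc]; exact hi⟩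
      · rw [snoc_monomialFamily]; exact hWg
      · calc (Eset σ (c ^ 2 * wronskian (⇑(jacDer u)) (fun k => monomial (f k) (1 : ℂ)))).card
            ≤ (Eset σ (c ^ 2) ∪ Eset σ (wronskian (⇑(jacDer u)) (fun k => monomial (f k) (1 : ℂ)))).card :=
              Finset.card_le_card (Eset_mul_subset hσ (pow_ne_zero 2 hc) hWf)
          _ ≤ (Eset σ (c ^ 2)).card + (Eset σ (wronskian (⇑(jacDer u)) (fun k => monomial (f k) (1 : ℂ)))).card :=
              Finset.card_union_le _ _
          _ ≤ (Eset σ c).card + B :=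
              Nat.add_le_add (Finset.card_le_card (Eset_pow_subset hσ c 2)) (hB l (by omega) f hf)
          _ ≤ (j + 1) * B := by rw [Nat.succ_mul]; exact Nat.add_le_add_right hcard _
      · rw [hstep i, hcol ⟨j, hjK⟩, hcol i, newCol_smul, newCol_wronskian, snoc_monomialFamily]
        ring

/-- ★ UNCONDITIONAL bound on the pivot column's edge directions: `|Eset σ (canCol u e j j)| ≤ K·B`. -/
theorem card_Eset_canCol_le_of_subflag {σ : ℝ} (hσ : σ = 1 ∨ σ = -1) {K : ℕ} (u : Poly2) (e : Fin K → Expo) {B : ℕ}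
    (hB : ∀ l, l ≤ K → ∀ f : Fin l → Expo, (∀ k, ∃ i, f k = e i) →
      (Eset σ (wronskian (⇑(jacDer u)) (fun k => monomial (f k) (1 : ℂ)))).card ≤ B) (j : Fin K) :
    (Eset σ (canCol u e j j)).card ≤ K * B := by
  obtain ⟨l, f, c, hl, hf, hc, _, hcard, hcol⟩ := canCol_eq_subflag hσ u e hB j (le_of_lt j.isLt)
  rw [hcol j]
  by_cases hWg : wronskian (⇑(jacDer u)) (Fin.snoc (fun k => monomial (f k) (1 : ℂ)) (monomial (e j) (1 : ℂ))) = 0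
  · rw [hWg, mul_zero, Eset_zero, Finset.card_empty]; exact Nat.zero_le _
  · have hf' : ∀ k, ∃ i, (Fin.snoc f (e j) : Fin (l + 1) → Expo) k = e i := by
      intro k
      refine Fin.lastCases ?_ (fun k' => ?_) k
      · exact ⟨j, by simp only [Fin.snoc_last]⟩
      · obtain ⟨i, hi⟩ := hf k'
        exact ⟨i, by simp only [Fin.snoc_castSucc]; exact hi⟩
    have hB' := hB (l + 1) (by have := j.isLt; omega) (Fin.snoc f (e j)) hf'
    rw [snoc_monomialFamily] at hB'
    calc (Eset σ (c * wronskian (⇑(jacDer u)) (Fin.snoc (fun k => monomial (f k) (1 : ℂ)) (monomial (e j) (1 : ℂ))))).card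
        ≤ (Eset σ c ∪ Eset σ (wronskian (⇑(jacDer u)) (Fin.snoc (fun k => monomial (f k) (1 : ℂ)) (monomial (e j) (1 : ℂ))))).card :=
          Finset.card_le_card (Eset_mul_subset hσ hc hWg)
      _ ≤ (Eset σ c).card + (Eset σ (wronskian (⇑(jacDer u)) (Fin.snoc (fun k => monomial (f k) (1 : ℂ)) (monomial (e j) (1 : ℂ))))).card :=
          Finset.card_union_le _ _
      _ ≤ (j : ℕ) * B + B := Nat.add_le_add hcard hB'
      _ = ((j : ℕ) + 1) * B := by rw [Nat.succ_mul]
      _ ≤ K * B := Nat.mul_le_mul_right _ j.isLt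

/-- ★ UNCONDITIONAL residue bound: `colResidue σ u e ≤ K·(K·B)`. -/
theorem colResidue_le_of_subflag {σ : ℝ} (hσ : σ = 1 ∨ σ = -1) {K : ℕ} (u : Poly2) (e : Fin K → Expo) {B : ℕ}
    (hB : ∀ l, l ≤ K → ∀ f : Fin l → Expo, (∀ k, ∃ i, f k = e i) →
      (Eset σ (wronskian (⇑(jacDer u)) (fun k => monomial (f k) (1 : ℂ)))).card ≤ B) :
    colResidue σ u e ≤ K * (K * B) := by
  unfold colResidue
  calc ∑ j : Fin K, (Eset σ (canCol u e j j)).card ≤ ∑ _j : Fin K, K * B :=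
        Finset.sum_le_sum fun j _ => card_Eset_canCol_le_of_subflag hσ u e hB j
    _ = K * (K * B) := by simp

/-! ### §2 «OLM columns law ⟸ (TW-flag)», unconditional in the columns -/

/-- a `TWFlagBound Q` bounds the Wronskian of EVERY monomial family of length `l ≤ K` by `Q K t` (pad the family to length `K`). [folklore] -/
theorem twFlagBound_family {Q : ℕ → ℕ → ℕ} (hQ : TWFlagBound Q) {σ : ℝ} (hσ : σ = 1 ∨ σ = -1) (K t : ℕ) (u : Poly2)
    (hu : u.support.card ≤ t) {l : ℕ} (hl : l ≤ K) (f : Fin l → Expo) :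
    (Eset σ (wronskian (⇑(jacDer u)) (fun k => monomial (f k) (1 : ℂ)))).card ≤ Q K t := by
  have key := hQ σ hσ K t u hu (fun k : Fin K => if h : (k : ℕ) < l then f ⟨k, h⟩ else 0) l hl
  have hflag : colFlag (fun k : Fin K => if h : (k : ℕ) < l then f ⟨k, h⟩ else 0) l = fun k => monomial (f k) (1 : ℂ) := by
    funext k
    unfold colFlag
    rw [eExt_of_lt _ (lt_of_lt_of_le k.isLt hl)]
    simp [k.isLt]
  rw [hflag] at key
  exact key

/-- ★★ **«OLM COLUMNS LAW ⟸ (TW-flag)», UNCONDITIONAL:** for ANY exponents `e` (repeated / resonant / ℂ(u)-dependent allowed), ANY columns `ψ` and any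
bound `Q` on the flags' edge directions, `nv (Σ_i X^{e_i}·ψ_i(u)) ≤ 2·(3K(t²+t) + 3K + 3K²·Q K t) + 4`. -/
theorem olmColumns_nv_le_of_twFlag_skip {Q : ℕ → ℕ → ℕ} (hQ : TWFlagBound Q) (K t : ℕ) (u : Poly2) (hu : u.support.card ≤ t)
    (e : Fin K → Expo) (ψ : Fin K → Polynomial ℂ) :
    nv (∑ i, monomial (e i) (1 : ℂ) * Polynomial.aeval u (ψ i)) ≤ 2 * (3 * K * (t * t + t) + 3 * K + 3 * (K * (K * Q K t))) + 4 := by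
  by_cases hS : (S1 u).Nonempty
  · have hX : ∀ σ : ℝ, (Xc σ u).card ≤ t * t + t :=
      fun σ => (card_Xc_le σ u).trans (Nat.add_le_add (Nat.mul_le_mul hu hu) hu)
    have h1 := card_Eset_columnSum_le_residue (σ := 1) (Or.inl rfl) hS e ψ
    have h2 := card_Eset_columnSum_le_residue (σ := -1) (Or.inr rfl) hS e ψ
    have r1 := colResidue_le_of_subflag (σ := 1) (Or.inl rfl) u e
      (fun l hl f _ => twFlagBound_family hQ (Or.inl rfl) K t u hu hl f)
    have r2 := colResidue_le_of_subflag (σ := -1) (Or.inr rfl) u e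
      (fun l hl f _ => twFlagBound_family hQ (Or.inr rfl) K t u hu hl f)
    have hn := nv_le (∑ i, monomial (e i) (1 : ℂ) * Polynomial.aeval u (ψ i))
    have a1 := hX 1; have a2 := hX (-1)
    have b1 : 3 * K * (Xc 1 u).card ≤ 3 * K * (t * t + t) := Nat.mul_le_mul_left _ a1
    have b2 : 3 * K * (Xc (-1) u).card ≤ 3 * K * (t * t + t) := Nat.mul_le_mul_left _ a2
    omega
  · -- constant carrier: `≤ K` monomials
    have huC : u = C (coeff 0 u) := eq_C_of_S1_empty hS
    have hval : ∀ i, Polynomial.aeval u (ψ i) = C ((ψ i).eval (coeff 0 u)) := fun i => by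
      rw [show Polynomial.aeval u (ψ i) = Polynomial.aeval (C (coeff 0 u) : Poly2) (ψ i) by rw [← huC]]
      exact aeval_C_eq _ _
    have hsum : ∑ i, monomial (e i) (1 : ℂ) * Polynomial.aeval u (ψ i) =
        ∑ i ∈ Finset.univ, (monomial (e i) ((ψ i).eval (coeff 0 u)) : Poly2) := by
      refine Finset.sum_congr rfl fun i _ => ?_
      rw [hval i, mul_comm, C_mul_monomial, mul_one]
    rw [hsum]
    have hK := (nv_le_card_support _).trans
      (card_support_sum_monomial_le Finset.univ e (fun i => (ψ i).eval (coeff 0 u)))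
    simp only [Finset.card_univ, Fintype.card_fin] at hK
    omega

/-! ### §3 Packaging in the OLM slot: `K = #columns ≤ (m+1)²`, and the body of `OLMLaw` from a polynomial `TWFlagBound` -/

/-- the number of u-free exponents (columns) of `P` is at most `(m+1)²` when `deg P ≤ m`. [folklore] -/
theorem card_ufree_image_le (P : Poly3) {m : ℕ} (hP : P.totalDegree ≤ m) : (P.support.image ufree).card ≤ (m + 1) ^ 2 := by
  have hsub : P.support.image ufree ⊆
      (Finset.range (m + 1) ×ˢ Finset.range (m + 1)).image (fun p => Finsupp.single 0 p.1 + Finsupp.single 1 p.2) := by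
    intro c hc
    rw [Finset.mem_image] at hc ⊢
    obtain ⟨s, hs, rfl⟩ := hc
    have hdeg : (s.sum fun _ n => n) ≤ m := (MvPolynomial.le_totalDegree hs).trans hP
    have h3 : (s.sum fun _ n => n) = s 0 + s 1 + s 2 := by
      rw [Finsupp.sum_fintype _ _ (fun _ => rfl)]; exact Fin.sum_univ_three _
    refine ⟨(s 0, s 1), ?_, rfl⟩
    rw [Finset.mem_product, Finset.mem_range, Finset.mem_range]; omega
  refine (Finset.card_le_card hsub).trans (Finset.card_image_le.trans ?_)
  rw [Finset.card_product, Finset.card_range, sq]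

/-- ★ the OLM slot through the columns, unconditionally: with `cols ⊇` the u-free exponents of `P` and `K = #cols`,
`nv (P(x, y, u)) ≤ 2·(3K(t²+t) + 3K + 3K²·Q K t) + 4`. -/
theorem olm_nv_le_of_twFlag {Q : ℕ → ℕ → ℕ} (hQ : TWFlagBound Q) (t : ℕ) (u : Poly2) (hu : u.support.card ≤ t) (P : Poly3)
    (cols : Finset Expo) (hP : ∀ s ∈ P.support, ufree s ∈ cols) :
    nv (MvPolynomial.aeval ![(X 0 : Poly2), X 1, u] P) ≤
      2 * (3 * cols.card * (t * t + t) + 3 * cols.card + 3 * (cols.card * (cols.card * Q cols.card t))) + 4 := by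
  rw [aeval_olm_eq_columnSum u P cols hP]
  have hre : ∑ c ∈ cols, monomial c (1 : ℂ) * Polynomial.aeval u (colPoly P c) =
      ∑ i : Fin cols.card, monomial ((cols.equivFin.symm i : cols) : Expo) (1 : ℂ) *
        Polynomial.aeval u (colPoly P ((cols.equivFin.symm i : cols) : Expo)) := by
    rw [← Finset.sum_coe_sort]
    exact (Fintype.sum_equiv cols.equivFin.symm _ _ (fun _ => rfl)).symm
  rw [hre]
  exact olmColumns_nv_le_of_twFlag_skip hQ cols.card t u hu _ _

/-- the closing arithmetic: `2·(3K(t²+t) + 3K + 3K²·(K+2)^a (t+2)^a) + 4 ≤ ((K+2)(t+2))^(a+5)`. [folklore] -/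
theorem olm_skip_arith (K t a : ℕ) :
    2 * (3 * K * (t * t + t) + 3 * K + 3 * (K * (K * ((K + 2) ^ a * (t + 2) ^ a)))) + 4 ≤ ((K + 2) * (t + 2)) ^ (a + 5) := by
  set Y := (K + 2) * (t + 2) with hY
  have hY4 : 4 ≤ Y := by rw [hY]; nlinarith
  have hYa : (K + 2) ^ a * (t + 2) ^ a = Y ^ a := by rw [hY, mul_pow]
  rw [hYa]
  have h1 : 3 * K * (t * t + t) ≤ Y ^ 2 := by
    have : 3 * K ≤ (K + 2) ^ 2 := by nlinarith
    have : t * t + t ≤ (t + 2) ^ 2 := by nlinarith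
    calc 3 * K * (t * t + t) ≤ (K + 2) ^ 2 * (t + 2) ^ 2 := Nat.mul_le_mul ‹3 * K ≤ (K + 2) ^ 2› ‹t * t + t ≤ (t + 2) ^ 2›
      _ = Y ^ 2 := by rw [hY, mul_pow]
  have h2 : 3 * K ≤ Y ^ 2 := by
    have : 3 * K ≤ (K + 2) ^ 2 := by nlinarith
    refine this.trans ?_
    rw [hY, mul_pow]
    exact Nat.le_mul_of_pos_right _ (by positivity)
  have h3 : 3 * (K * (K * Y ^ a)) ≤ Y ^ (a + 3) := by
    have hK3 : 3 * (K * K) ≤ (K + 2) ^ 3 := by nlinarith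
    have : (K + 2) ^ 3 ≤ Y ^ 3 := by rw [hY, mul_pow]; exact Nat.le_mul_of_pos_right _ (by positivity)
    calc 3 * (K * (K * Y ^ a)) = 3 * (K * K) * Y ^ a := by ring
      _ ≤ Y ^ 3 * Y ^ a := Nat.mul_le_mul_right _ (hK3.trans this)
      _ = Y ^ (a + 3) := by rw [← pow_add, add_comm]
  have hY1 : 1 ≤ Y := by omega
  have hp2 : Y ^ 2 ≤ Y ^ (a + 3) := Nat.pow_le_pow_right hY1 (by omega)
  have hp1 : Y ≤ Y ^ (a + 3) := by
    calc Y = Y ^ 1 := (pow_one Y).symm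
      _ ≤ Y ^ (a + 3) := Nat.pow_le_pow_right hY1 (by omega)
  have h4 : 4 ≤ Y ^ (a + 3) := hY4.trans hp1
  have hfin : 7 * Y ^ (a + 3) ≤ Y ^ (a + 5) := by
    have he : Y ^ (a + 5) = Y ^ (a + 3) * Y ^ 2 := by rw [← pow_add]
    rw [he]
    have h7 : 7 ≤ Y ^ 2 := by nlinarith
    calc 7 * Y ^ (a + 3) = Y ^ (a + 3) * 7 := by ring
      _ ≤ Y ^ (a + 3) * Y ^ 2 := Nat.mul_le_mul_left _ h7
  linarith

/-- ★★ **THE BODY OF `OLMLaw` FROM A POLYNOMIAL (TW-flag):** if `TWFlagBound Q` holds with `Q K t ≤ (K+2)^a (t+2)^a`, then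
`∃ c, ∀ m t P u, deg P ≤ m → |supp u| ≤ t → nv (P(x, y, u)) ≤ (m+2)^c (t+2)^c` (`c = 2a + 10`).  This is literally the statement `OLMLaw` of the
Cruxes workfile (val-idea-35 g11), obtained there by `exact olm_nv_le_pow_of_twFlag hQ hQa`; `TWFlagBound Q` itself is OPEN beyond one resonance line. -/
theorem olm_nv_le_pow_of_twFlag {Q : ℕ → ℕ → ℕ} (hQ : TWFlagBound Q) {a : ℕ} (hQa : ∀ K t, Q K t ≤ (K + 2) ^ a * (t + 2) ^ a) :
    ∃ c : ℕ, ∀ (m t : ℕ) (P : Poly3) (u : Poly2),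
      P.totalDegree ≤ m → u.support.card ≤ t →
      nv (MvPolynomial.aeval ![X 0, X 1, u] P) ≤ (m + 2) ^ c * (t + 2) ^ c := by
  refine ⟨2 * a + 10, fun m t P u hP hu => ?_⟩
  set K := (P.support.image ufree).card with hK
  have hcols : ∀ s ∈ P.support, ufree s ∈ P.support.image ufree := fun s hs => Finset.mem_image_of_mem _ hs
  have h0 := olm_nv_le_of_twFlag hQ t u hu P (P.support.image ufree) hcols
  rw [← hK] at h0
  have hKm : K ≤ (m + 1) ^ 2 := card_ufree_image_le P hP
  have h1 : nv (MvPolynomial.aeval ![X 0, X 1, u] P) ≤ ((K + 2) * (t + 2)) ^ (a + 5) := by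
    refine h0.trans ((Nat.add_le_add_right (Nat.mul_le_mul_left 2 (Nat.add_le_add_left (Nat.mul_le_mul_left 3
      (Nat.mul_le_mul_left K (Nat.mul_le_mul_left K (hQa K t)))) _)) 4).trans ?_)
    exact olm_skip_arith K t a
  have hK2 : K + 2 ≤ (m + 2) ^ 2 := by nlinarith
  calc nv (MvPolynomial.aeval ![X 0, X 1, u] P) ≤ ((K + 2) * (t + 2)) ^ (a + 5) := h1
    _ = (K + 2) ^ (a + 5) * (t + 2) ^ (a + 5) := mul_pow _ _ _
    _ ≤ ((m + 2) ^ 2) ^ (a + 5) * (t + 2) ^ (2 * a + 10) :=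
        Nat.mul_le_mul (Nat.pow_le_pow_left hK2 _) (Nat.pow_le_pow_right (by omega) (by omega))
    _ = (m + 2) ^ (2 * a + 10) * (t + 2) ^ (2 * a + 10) := by rw [← pow_mul]; ring_nf

end TowerKernel

end Summit.ValiantsHypothesis.ValiantsHypothesis.Theorems.TwoProducts.RankTwoJacobian

end
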